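import Summits.KontsevichZagierPeriods.Zeta5Search.WedgeDictionaryOmegaRecCore

/-!
# Wedge dictionary — REC3′ (L8), part 2/3: the summand, the certificate, the pivot cross relations, REC3′ at a generic running parameter

HONEST FRAMING: systematic search; no irrationality claim unless certified.

Part 2 of gen-1 g5's `WedgeDictionaryOmegaRec` (see part 1 for provenance; main header in part 3).
-/

noncomputable section

open Finset Polynomial

namespace Summit.KontsevichZagierPeriods.Zeta5Search.WedgeDictionary.OmegaRec

open Summit.KontsevichZagierPeriods.Zeta5Search.Hypergeometric

/-! ## The summand, the certificate and the five pivot cross relations (char-0 field `K`) -/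
section FieldPart
variable {K : Type*} [Field K] [CharZero K] {L : Type*} [Field L] [CharZero L]

/-- the slot-independent core `ω(μ)`. -/
def om (n : K) (c : Fin 6 → K) (μ : ℕ) : K :=
  (1 - 2 * (μ : K) / (n + 1)) * (ph (-n - 1) μ / (μ.factorial : K)) *
    ∏ i, ph (-c i) μ / ph (c i - n) μ

/-- the summand `T(x, μ) = ω(μ)·(−x)_μ/(x−n)_μ`. -/
def tT (n : K) (c : Fin 6 → K) (x : K) (μ : ℕ) : K := om n c μ * (ph (-x) μ / ph (x - n) μ)

/-- the pole-free certificate value `G(x, μ)`:  `G(x,0) = 0`,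
`G(x,k+1) = −(−n−1)_{k+1}/((n+1)k!) · (−x)_k/(x−n)_{k+1} · ∏ᵢ (−cᵢ)_{k+1}/(cᵢ−n)_k`. -/
def gG (n : K) (c : Fin 6 → K) (x : K) : ℕ → K
  | 0 => 0
  | k + 1 => -(ph (-n - 1) (k + 1) / ((n + 1) * (k.factorial : K))) * (ph (-x) k / ph (x - n) (k + 1)) *
      ∏ i, ph (-c i) (k + 1) / ph (c i - n) k

omit [CharZero K] in
/-- `G(x,0) = 0` (pole-free certificate at the left boundary). -/
@[simp] theorem gG_zero (n : K) (c : Fin 6 → K) (x : K) : gG n c x 0 = 0 := rfl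

omit [CharZero K] in
/-- CROSS RELATION (+1):  `T(x+1,μ)·(x+1−μ)(x−n+μ) = T(x,μ)·(x+1)(x−n)`. -/
theorem tT_up (n : K) (c : Fin 6 → K) (x : K) (μ : ℕ)
    (h0 : ph (x - n) μ ≠ 0) (h1 : ph (x + 1 - n) μ ≠ 0) :
    tT n c (x + 1) μ * ((x + 1 - μ) * (x - n + μ)) = tT n c x μ * ((x + 1) * (x - n)) := by
  have s1 := ph_shift (-(x + 1)) μ
  have e1 : (-(x + 1) + 1 : K) = -x := by ring
  rw [e1] at s1
  have s2 := ph_shift (x - n) μ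
  have e2 : (x - n + 1 : K) = x + 1 - n := by ring
  rw [e2] at s2
  unfold tT
  rw [mul_assoc, mul_assoc, div_mul_eq_mul_div, div_mul_eq_mul_div]
  congr 1
  rw [div_eq_div_iff h1 h0]
  linear_combination (-(ph (x - n) μ) * (x - n + (μ : K))) * s1 + ((x + 1) * ph (-x) μ) * s2

omit [CharZero K] in
/-- CROSS RELATION (−1):  `T(x−1,μ)·x(x−n−1) = T(x,μ)·(x−μ)(x−n+μ−1)`. -/
theorem tT_down1 (n : K) (c : Fin 6 → K) (x : K) (μ : ℕ)
    (h0 : ph (x - n) μ ≠ 0) (h1 : ph (x - 1 - n) μ ≠ 0) :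
    tT n c (x - 1) μ * (x * (x - n - 1)) = tT n c x μ * ((x - μ) * (x - n + μ - 1)) := by
  have s1 := ph_shift (-x) μ
  have e1 : (-x + 1 : K) = -(x - 1) := by ring
  rw [e1] at s1
  have s2 := ph_shift (x - 1 - n) μ
  have e2 : (x - 1 - n + 1 : K) = x - n := by ring
  rw [e2] at s2
  unfold tT
  rw [mul_assoc, mul_assoc, div_mul_eq_mul_div, div_mul_eq_mul_div]
  congr 1
  rw [div_eq_div_iff h1 h0]
  linear_combination ((x - n - 1) * ph (x - n) μ) * s1 - (ph (-x) μ * (x - (μ : K))) * s2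

omit [CharZero K] in
/-- CROSS RELATION (−2):  `T(x−2,μ)·x(x−1)(x−n−1)(x−n−2) = T(x,μ)·(x−μ)(x−1−μ)(x−n+μ−1)(x−n+μ−2)`. -/
theorem tT_down2 (n : K) (c : Fin 6 → K) (x : K) (μ : ℕ)
    (h0 : ph (x - n) μ ≠ 0) (h1 : ph (x - 1 - n) μ ≠ 0) (h2 : ph (x - 2 - n) μ ≠ 0) :
    tT n c (x - 2) μ * (x * (x - 1) * (x - n - 1) * (x - n - 2)) =
      tT n c x μ * ((x - μ) * (x - 1 - μ) * (x - n + μ - 1) * (x - n + μ - 2)) := by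
  have hA := tT_down1 n c x μ h0 h1
  have hB := tT_down1 n c (x - 1) μ h1 (by
    have e : (x - 1 - 1 - n : K) = x - 2 - n := by ring
    rw [e]; exact h2)
  have e3 : (x - 1 - 1 : K) = x - 2 := by ring
  rw [e3] at hB
  linear_combination (x * (x - n - 1)) * hB + ((x - 1 - (μ : K)) * (x - 1 - n + (μ : K) - 1)) * hA


/-- CROSS RELATION (G, μ+1):  `G(x,μ+1)·(n+1−2μ)(x−n+μ) = −T(x,μ)·(μ−n−1)·E(μ)`. -/
theorem gG_rel1 (n : K) (c : Fin 6 → K) (x : K) (μ : ℕ)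
    (hn : (n : K) + 1 ≠ 0) (hc : ∀ i, ph (c i - n) μ ≠ 0) (hx : ph (x - n) (μ + 1) ≠ 0) :
    gG n c x (μ + 1) * ((n + 1 - 2 * (μ : K)) * (x - n + μ)) =
      tT n c x μ * (-((μ : K) - n - 1) * EK c μ) := by
  have hx' : ph (x - n) μ ≠ 0 ∧ (x - n + (μ : K)) ≠ 0 := by
    rw [ph_succ] at hx; exact mul_ne_zero_iff.mp hx
  have hfac : ((μ.factorial : ℕ) : K) ≠ 0 := by exact_mod_cast (Nat.factorial_pos μ).ne'
  have h0 := hc 0; have h1 := hc 1; have h2 := hc 2; have h3 := hc 3; have h4 := hc 4; have h5 := hc 5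
  obtain ⟨hxa, hxb⟩ := hx'
  simp only [gG, tT, om, EK, Fin.prod_univ_six, ph_succ]
  field_simp
  ring

/-- CROSS RELATION (G, μ):  `G(x,μ)·(n+1−2μ)(x+1−μ) = T(x,μ)·μ·E(n+1−μ)` (both sides vanish for `μ = 0`). -/
theorem gG_rel0 (n : K) (c : Fin 6 → K) (x : K) (μ : ℕ)
    (hn : (n : K) + 1 ≠ 0) (hc : ∀ i, ph (c i - n) μ ≠ 0) (hx : ph (x - n) μ ≠ 0) :
    gG n c x μ * ((n + 1 - 2 * (μ : K)) * (x + 1 - μ)) =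
      tT n c x μ * ((μ : K) * EK c (n + 1 - μ)) := by
  cases μ with
  | zero => simp [gG]
  | succ k =>
    have hc' : ∀ i, ph (c i - n) k ≠ 0 ∧ (c i - n + (k : K)) ≠ 0 := fun i => by
      have := hc i; rw [ph_succ] at this; exact mul_ne_zero_iff.mp this
    have hfac : ((k.factorial : ℕ) : K) ≠ 0 := by exact_mod_cast (Nat.factorial_pos k).ne'
    have hk1 : ((k : K) + 1) ≠ 0 := by exact_mod_cast Nat.succ_ne_zero k
    -- the side products: `∏ (−cᵢ)_{k+1}/(cᵢ−n)_k = (∏ (−cᵢ)_{k+1}/(cᵢ−n)_{k+1}) · ∏ (cᵢ−n+k)`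
    have hPg : (∏ i, ph (-c i) (k + 1) / ph (c i - n) k) =
        (∏ i, ph (-c i) (k + 1) / ph (c i - n) (k + 1)) * ∏ i, (c i - n + (k : K)) := by
      rw [← Finset.prod_mul_distrib]
      refine Finset.prod_congr rfl (fun i _ => ?_)
      obtain ⟨ha, hb⟩ := hc' i
      rw [ph_succ (c i - n) k]
      field_simp
    have hE : EK c (n + 1 - ((k : K) + 1)) = ∏ i, (c i - n + (k : K)) := by
      unfold EK; simp only [Fin.prod_univ_six]; ring
    simp only [gG, tT, om]
    push_cast
    rw [hPg, hE, ph_succ (-x) k, Nat.factorial_succ]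
    push_cast
    generalize (∏ i, ph (-c i) (k + 1) / ph (c i - n) (k + 1)) = P
    generalize (∏ i, (c i - n + (k : K))) = Q
    field_simp
    ring



omit [CharZero K] [CharZero L] in
/-- `ph` commutes with ring homs. -/
theorem ph_map (f : K →+* L) (a : K) (k : ℕ) : f (ph a k) = ph (f a) k := by
  unfold ph
  rw [← Polynomial.eval₂_hom, ← Polynomial.eval_map, ascPochhammer_map]

omit [CharZero K] in
/-- `ph y k = ∏_{j<k} (y + j)`. -/
theorem ph_eq_prod (y : K) (k : ℕ) : ph y k = ∏ j ∈ range k, (y + j) := by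
  induction k with
  | zero => simp [ph_zero]
  | succ k ih => rw [ph_succ, ih, Finset.prod_range_succ]

omit [CharZero K] in
/-- a rising factorial with non-zero factors is non-zero. -/
theorem ph_ne_zero_of (y : K) (k : ℕ) (h : ∀ j < k, y + (j : K) ≠ 0) : ph y k ≠ 0 := by
  rw [ph_eq_prod]
  exact Finset.prod_ne_zero_iff.mpr (fun j hj => h j (Finset.mem_range.mp hj))

omit [CharZero K] [CharZero L] in
/-- `om` commutes with ring homs. -/
theorem om_map (f : K →+* L) (n : K) (c : Fin 6 → K) (μ : ℕ) :
    f (om n c μ) = om (f n) (fun i => f (c i)) μ := by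
  simp only [om, map_mul, map_sub, map_div₀, map_prod, ph_map, map_neg, map_one, map_ofNat, map_natCast,
    map_add]

omit [CharZero K] [CharZero L] in
/-- `tT` commutes with ring homs. -/
theorem tT_map (f : K →+* L) (n : K) (c : Fin 6 → K) (x : K) (μ : ℕ) :
    f (tT n c x μ) = tT (f n) (fun i => f (c i)) (f x) μ := by
  simp only [tT, map_mul, map_div₀, om_map, ph_map, map_neg, map_sub]

/-! ## The termwise certificate identity and REC3′ (generic running parameter `x`) -/

/-- non-vanishing hypotheses at level `μ` (denominators and pivots). -/
def Good (n : K) (c : Fin 6 → K) (x : K) (μ : ℕ) : Prop :=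
  n + 1 ≠ 0 ∧ (∀ i, ph (c i - n) μ ≠ 0) ∧ ph (x - n) (μ + 1) ≠ 0 ∧ ph (x + 1 - n) μ ≠ 0 ∧
    ph (x - 1 - n) μ ≠ 0 ∧ ph (x - 2 - n) μ ≠ 0 ∧ Zpiv n x (μ : K) ≠ 0

/-- TERMWISE CERTIFICATE IDENTITY:
`Pup·T(x+1,μ) + Pz·T(x,μ) + Pm1·T(x−1,μ) + Pm2·T(x−2,μ) = (n−x)(G(x,μ+1) − G(x,μ))`. -/
theorem termwise (n : K) (c : Fin 6 → K) (x : K) (μ : ℕ) (hg : Good n c x μ) :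
    Pup n c x * tT n c (x + 1) μ + Pz n c x * tT n c x μ + Pm1 n c x * tT n c (x - 1) μ +
        Pm2 n c x * tT n c (x - 2) μ = (n - x) * (gG n c x (μ + 1) - gG n c x μ) := by
  obtain ⟨hn, hc, hx0, hx1, hxm1, hxm2, hZ⟩ := hg
  have hx0' : ph (x - n) μ ≠ 0 := by
    have := hx0; rw [ph_succ] at this; exact (mul_ne_zero_iff.mp this).1
  have h1 := tT_up n c x μ hx0' hx1
  have hm1 := tT_down1 n c x μ hx0' hxm1
  have hm2 := tT_down2 n c x μ hx0' hxm1 hxm2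
  have hg0 := gG_rel0 n c x μ hn hc hx0'
  have hg1 := gG_rel1 n c x μ hn hc hx0
  rw [EK_eq] at hg0 hg1
  have H := termwise_of_pivot n x (μ : K) (eS1 c) (eS2 c) (eS3 c) (eS4 c) (eS5 c) (eS6 c)
    (tT n c x μ) (tT n c (x + 1) μ) (tT n c (x - 1) μ) (tT n c (x - 2) μ) (gG n c x μ) (gG n c x (μ + 1))
    h1 hm1 hm2 hg0 hg1
  have H' := mul_left_cancel₀ hZ H
  simp only [Pup, Pz, Pm1, Pm2, EK_eq]
  linear_combination H'

/-- partial sums `Σ_{μ ≤ M} T(x, μ)` (= `Ω` in the running slot once `M ≥ min c`). -/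
def OmS (n : K) (c : Fin 6 → K) (x : K) (M : ℕ) : K := ∑ μ ∈ range (M + 1), tT n c x μ

/-- telescoped partial sums. -/
theorem partial_sum (n : K) (c : Fin 6 → K) (x : K) (M : ℕ) (hg : ∀ μ ≤ M, Good n c x μ) :
    Pup n c x * OmS n c (x + 1) M + Pz n c x * OmS n c x M + Pm1 n c x * OmS n c (x - 1) M +
        Pm2 n c x * OmS n c (x - 2) M = (n - x) * gG n c x (M + 1) := by
  induction M with
  | zero =>
    have h0 := termwise n c x 0 (hg 0 le_rfl)
    simp only [OmS, zero_add, Finset.sum_range_one, gG_zero, sub_zero] at h0 ⊢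
    exact h0
  | succ M ih =>
    have ih' := ih (fun μ hμ => hg μ (Nat.le_succ_of_le hμ))
    have hM := termwise n c x (M + 1) (hg (M + 1) le_rfl)
    simp only [OmS] at ih' ⊢
    rw [Finset.sum_range_succ _ (M + 1), Finset.sum_range_succ _ (M + 1), Finset.sum_range_succ _ (M + 1),
      Finset.sum_range_succ _ (M + 1)]
    linear_combination ih' + hM

omit [CharZero K] in
/-- the certificate vanishes past the termination point: `(−cᵢ)_{M+1} = 0 ⇒ G(x, M+1) = 0`. -/
theorem gG_eq_zero (n : K) (c : Fin 6 → K) (x : K) (M : ℕ) (i : Fin 6) (hi : ph (-c i) (M + 1) = 0) :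
    gG n c x (M + 1) = 0 := by
  simp only [gG]
  rw [Finset.prod_eq_zero (Finset.mem_univ i) (by rw [hi, zero_div])]
  ring

/-- **REC3′ (generic running parameter).**  If some `(−cᵢ)_{M+1} = 0` (termination) and the
non-vanishing hypotheses hold for every `μ ≤ M`, then
`−E(n−x)·Ω(x+1) + (n−x)(P₀(x)Ω(x) + P₋₁(x)Ω(x−1) + P₋₂(x)Ω(x−2)) = 0`, `Ω(y) = Σ_{μ≤M} T(y,μ)`. -/
theorem rec3' (n : K) (c : Fin 6 → K) (x : K) (M : ℕ) (hg : ∀ μ ≤ M, Good n c x μ)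
    (i : Fin 6) (hi : ph (-c i) (M + 1) = 0) :
    Pup n c x * OmS n c (x + 1) M + Pz n c x * OmS n c x M + Pm1 n c x * OmS n c (x - 1) M +
        Pm2 n c x * OmS n c (x - 2) M = 0 := by
  rw [partial_sum n c x M hg, gG_eq_zero n c x M i hi, mul_zero]

end FieldPart

end Summit.KontsevichZagierPeriods.Zeta5Search.WedgeDictionary.OmegaRec
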